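import Mathlib
import Summits.Ventures.PercRepro.TriangleCapSubBandTwo

/-!
# PercRepro — THE THIRD GAP AND THE TOP THREE SUB-BANDS OF THE BAND ON `n` VERTICES, EXACTLY (p3, gen 52; part 259)

With `ℓ + 8 ≤ t` non-neighbours of `w`, the band value `2 j` is in one of the three first sub-bands or at least
`3 (t − 4)` (`third_gap`): `j ≤ ℓ − 1` (the star), `t − 2 ≤ j ≤ t + ℓ − 3` (a vertex of off-degree `t − 1`, part 255),
`2 t − 6 ≤ j ≤ 2 t − 6 + ℓ` (off-degree `t − 2`, parts 252 and 257 — a neighbour of `w` carries at most `ℓ` off-edges,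
so these vertices are non-neighbours), or every off-degree is `≤ t − 3` and either some vertex has off-degree
`≥ 4` (`j ≥ u (t − u − 1) ≥ 3 (t − 4)`) or every off-degree is `≤ 3` (`offAdjPairs ≤ 4 t`, `2 j ≥ t (t − 5) ≥ 6 (t − 4)`
for `t ≥ 8`).  Hence on `ℓ + 1 + (s − t)` vertices (`2 ≤ ℓ`, `ℓ + 8 ≤ t`, `2 t ≤ s`) the band values `j ≤ 3 t − 13` are
EXACTLY `j ≤ ℓ − 1`, `t − 2 ≤ j ≤ t + ℓ − 3` and `2 t − 6 ≤ j ≤ 2 t − 6 + ℓ` (`band_below_third_iff`, with the witnesses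
of parts 254 and 258), and the values `2 t − 5 + ℓ ≤ j ≤ 3 t − 13` are not attained (`third_gap_not_attained`).
Axioms: standard.
-/

namespace PercRepro

namespace TriangleCap

namespace C047

open Finset

variable {V : Type*} [Fintype V] [DecidableEq V]

/-- A neighbour of `w` carries at most `|nonNbrs|` off-edges: their second ends are distinct non-neighbours (the
lemma of part 256, restated here so that this module does not wait on that module's build). -/
theorem offDeg_le_card_nonNbrs_of_adj' (H : SimpleGraph V) [DecidableRel H.Adj] (hfree : H.CliqueFree 3) (w x : V)
    (hxN : H.Adj w x) : offDeg H w x ≤ (nonNbrs H w).card := by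
  unfold offDeg
  apply card_le_card_of_injOn (otherEnd x)
  · intro e he
    rw [mem_coe, mem_filter] at he
    rw [mem_coe]
    have hne := mem_edgeFinset_of_mem_offEdges H w he.1
    have hdiag : ¬ e.IsDiag := H.not_isDiag_of_mem_edgeSet (SimpleGraph.mem_edgeFinset.mp hne)
    unfold otherEnd
    rw [dif_pos he.2, mem_nonNbrs]
    refine ⟨?_, ?_⟩
    · intro hw
      exact notMem_of_mem_offEdges H w he.1 (hw ▸ Sym2.other_mem he.2)
    · intro hy
      have hone := card_adj_mem_le_one H hfree w e hne
      have : 1 < (univ.filter (fun v => H.Adj w v ∧ v ∈ e)).card :=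
        one_lt_card.mpr ⟨x, mem_filter.mpr ⟨mem_univ _, hxN, he.2⟩, Sym2.Mem.other he.2,
          mem_filter.mpr ⟨mem_univ _, hy, Sym2.other_mem he.2⟩, (Sym2.other_ne hdiag he.2).symm⟩
      omega
  · intro e he e' he' heq
    rw [mem_coe, mem_filter] at he he'
    unfold otherEnd at heq
    rw [dif_pos he.2, dif_pos he'.2] at heq
    rw [← Sym2.other_spec he.2, ← Sym2.other_spec he'.2, heq]

/-- Every off-degree `≤ 3` ⇒ `offAdjPairs ≤ 4 |F|`. -/
theorem offAdjPairs_le_of_offDeg_le_three (H : SimpleGraph V) [DecidableRel H.Adj] (w : V)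
    (h : ∀ v, offDeg H w v ≤ 3) : offAdjPairs H w ≤ 4 * (offEdges H w).card := by
  rw [← sum_erase_offDeg_mul_pred]
  have := sum_erase_offDeg H w
  have hle : ∑ v ∈ (univ : Finset V).erase w, offDeg H w v * (offDeg H w v - 1) ≤
      ∑ v ∈ (univ : Finset V).erase w, 2 * offDeg H w v := by
    apply sum_le_sum
    intro v _
    have := h v
    have hc : offDeg H w v = 0 ∨ offDeg H w v = 1 ∨ offDeg H w v = 2 ∨ offDeg H w v = 3 := by omega
    rcases hc with hc | hc | hc | hc <;> simp [hc]
  rw [← mul_sum] at hle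
  omega

/-- The arithmetic of the third gap: `3 ≤ u`, `u + 4 ≤ t` ⇒ `3 (t − 4) ≤ u (t − u − 1)`. -/
theorem three_mul_sub_four_le_mul (t u : ℕ) (hu1 : 3 ≤ u) (hu2 : u + 4 ≤ t) : 3 * (t - 4) ≤ u * (t - u - 1) := by
  obtain ⟨u', rfl⟩ : ∃ u', u = u' + 3 := ⟨u - 3, by omega⟩
  obtain ⟨v, rfl⟩ : ∃ v, t = u' + 3 + v + 4 := ⟨t - u' - 7, by omega⟩
  have e : u' + 3 + v + 4 - (u' + 3) - 1 = v + 3 := by omega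
  have e' : u' + 3 + v + 4 - 4 = u' + v + 3 := by omega
  rw [e, e']
  nlinarith

/-- **THE THIRD GAP:** with `ℓ + 8 ≤ t` non-neighbours, at the band value `2 j`: `j + 1 ≤ ℓ`, or
`t ≤ j + 2 ∧ j + 3 ≤ t + ℓ`, or `2 t ≤ j + 6 ∧ j + 6 ≤ 2 t + ℓ`, or `3 t ≤ j + 12`. -/
theorem third_gap (H : SimpleGraph V) [DecidableRel H.Adj] (hfree : H.CliqueFree 3) (s t j : ℕ)
    (hs : H.edgeFinset.card = s) (w : V) (hw : 1 ≤ deg H w) (ht : (offEdges H w).card = t)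
    (hj : ∑ v, deg H v * deg H v + 2 * (t * (s - t - 1)) + 2 * j = s * (s + 1))
    (hℓ : (nonNbrs H w).card + 8 ≤ t) :
    j + 1 ≤ (nonNbrs H w).card ∨ (t ≤ j + 2 ∧ j + 3 ≤ t + (nonNbrs H w).card) ∨
      (2 * t ≤ j + 6 ∧ j + 6 ≤ 2 * t + (nonNbrs H w).card) ∨ 3 * t ≤ j + 12 := by
  by_cases h0 : ∃ x, offDeg H w x = t
  · obtain ⟨x, hx⟩ := h0
    left
    exact band_succ_le_of_star H hfree s t j hs w hw ht hj x hx (by omega)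
  by_cases h1 : ∃ x, offDeg H w x + 1 = t
  · obtain ⟨x, hx⟩ := h1
    right; left
    have hxN : ¬ H.Adj w x := by
      intro hxN
      have := offDeg_le_card_nonNbrs_of_adj' H hfree w x hxN
      omega
    refine ⟨?_, band_le_of_offDeg_pred H hfree s t j hs w hw ht hj x hx hxN (by omega)⟩
    have := subband_lower_bound H hfree s t 1 j hs w hw ht hj x hx
    omega
  by_cases h2 : ∃ x, offDeg H w x + 2 = t
  · obtain ⟨x, hx⟩ := h2
    right; right; left
    have hxN : ¬ H.Adj w x := by
      intro hxN
      have := offDeg_le_card_nonNbrs_of_adj' H hfree w x hxN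
      omega
    have hlow := subband_lower_bound H hfree s t 2 j hs w hw ht hj x hx
    have hup := subband_upper_bound H hfree s t 2 j hs w hw ht hj x hx hxN (by omega) 1 le_rfl
    have hpos : 0 < (nonNbrs H w).card := by
      obtain ⟨y, hy, _⟩ := exists_nonNbr_offDeg_pos H hfree w (by omega)
      exact card_pos.mpr ⟨y, hy⟩
    obtain ⟨l', hl'⟩ : ∃ l', (nonNbrs H w).card = l' + 1 := ⟨(nonNbrs H w).card - 1, by omega⟩
    obtain ⟨t', rfl⟩ : ∃ t', t = t' + 3 := ⟨t - 3, by omega⟩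
    rw [hl'] at hup hℓ ⊢
    norm_num at hlow hup
    omega
  by_cases h3 : ∃ x, 4 ≤ offDeg H w x
  · obtain ⟨x, hx⟩ := h3
    right; right; right
    simp only [not_exists] at h0 h1 h2
    have hle := offDeg_le_card H w x
    rw [ht] at hle
    have hne0 := h0 x
    have hne1 := h1 x
    have hne2 := h2 x
    have hb := subband_lower_bound H hfree s t (t - offDeg H w x) j hs w hw ht hj x (by omega)
    have := three_mul_sub_four_le_mul t (t - offDeg H w x) (by omega) (by omega)
    omega
  · right; right; right
    simp only [not_exists, not_le] at h3
    have hval := (layer_value_iff H s t j hs w hw ht).mp hj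
    have hatt := attach_le H hfree w
    rw [ht] at hatt
    have hP := offAdjPairs_le_of_offDeg_le_three H w (fun v => by have := h3 v; omega)
    rw [ht] at hP
    obtain ⟨t', rfl⟩ : ∃ t', t = t' + 8 := ⟨t - 8, by omega⟩
    nlinarith

/-- **THE THIRD GAP ON `n` VERTICES:** on `ℓ + 1 + (s − t)` vertices with `ℓ + 8 ≤ t`, at the band value `2 j` of a
vertex of degree `s − t ≥ 1`: `j + 1 ≤ ℓ`, or `t ≤ j + 2 ∧ j + 3 ≤ t + ℓ`, or `2 t ≤ j + 6 ∧ j + 6 ≤ 2 t + ℓ`, or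
`3 t ≤ j + 12`. -/
theorem third_gap_vertices (ℓ s t : ℕ) (H : SimpleGraph (Fin (ℓ + 1 + (s - t)))) [DecidableRel H.Adj]
    (hfree : H.CliqueFree 3) (hs : H.edgeFinset.card = s) (w : Fin (ℓ + 1 + (s - t))) (hw : deg H w + t = s)
    (hw1 : 1 ≤ deg H w) (hℓ : ℓ + 8 ≤ t) (j : ℕ)
    (hj : ∑ v, deg H v * deg H v + 2 * (t * (s - t - 1)) + 2 * j = s * (s + 1)) :
    j + 1 ≤ ℓ ∨ (t ≤ j + 2 ∧ j + 3 ≤ t + ℓ) ∨ (2 * t ≤ j + 6 ∧ j + 6 ≤ 2 * t + ℓ) ∨ 3 * t ≤ j + 12 := by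
  have hc := card_nonNbrs_add H w
  rw [Fintype.card_fin] at hc
  have hcard := card_offEdges_add_deg H w
  have hℓ' : (nonNbrs H w).card = ℓ := by omega
  have := third_gap H hfree s t j hs w hw1 (by omega) hj (by omega)
  rw [hℓ'] at this
  exact this

/-- **THE THIRD GAP IS A GAP:** for `ℓ + 8 ≤ t`, `2 t ≤ s`, no triangle-free graph on `ℓ + 1 + (s − t)` vertices with
`s` edges and a vertex of degree `s − t` has the band value `2 j` with `2 t − 5 + ℓ ≤ j ≤ 3 t − 13`. -/
theorem third_gap_not_attained (ℓ s t j : ℕ) (ht : ℓ + 8 ≤ t) (hs : 2 * t ≤ s) (hj1 : 2 * t + ℓ ≤ j + 5)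
    (hj2 : j + 13 ≤ 3 * t) :
    ¬ ∃ (H : SimpleGraph (Fin (ℓ + 1 + (s - t)))) (_ : DecidableRel H.Adj), H.CliqueFree 3 ∧
      H.edgeFinset.card = s ∧ (∃ w, deg H w + t = s) ∧
      ∑ v, deg H v * deg H v + 2 * (t * (s - t - 1)) + 2 * j = s * (s + 1) := by
  rintro ⟨H, _, hfree, hs', ⟨w, hw⟩, hj'⟩
  have := third_gap_vertices ℓ s t H hfree hs' w hw (by omega) ht j hj'
  omega

/-- **THE BAND ON `n` VERTICES BELOW `3 t − 12`, EXACTLY:** for `2 ≤ ℓ`, `ℓ + 8 ≤ t`, `2 t ≤ s` and `j + 13 ≤ 3 t`, the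
band value `2 j` is attained on `ℓ + 1 + (s − t)` vertices iff `j ≤ ℓ − 1`, or `t − 2 ≤ j ≤ t + ℓ − 3`, or
`2 t − 6 ≤ j ≤ 2 t − 6 + ℓ`. -/
theorem band_below_third_iff (ℓ s t j : ℕ) (hℓ : 2 ≤ ℓ) (ht : ℓ + 8 ≤ t) (hs : 2 * t ≤ s)
    (hj : j + 13 ≤ 3 * t) :
    (∃ (H : SimpleGraph (Fin (ℓ + 1 + (s - t)))) (_ : DecidableRel H.Adj), H.CliqueFree 3 ∧
      H.edgeFinset.card = s ∧ (∃ w, deg H w + t = s) ∧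
      ∑ v, deg H v * deg H v + 2 * (t * (s - t - 1)) + 2 * j = s * (s + 1)) ↔
    (j + 1 ≤ ℓ ∨ (t ≤ j + 2 ∧ j + 3 ≤ t + ℓ) ∨ (2 * t ≤ j + 6 ∧ j + 6 ≤ 2 * t + ℓ)) := by
  constructor
  · rintro ⟨H, _, hfree, hs', ⟨w, hw⟩, hj'⟩
    have := third_gap_vertices ℓ s t H hfree hs' w hw (by omega) ht j hj'
    omega
  · rintro (h | h | h)
    · exact starWitness ℓ s t j (by omega) hs h (by omega)
    · exact (top_of_band_vertices_iff ℓ s t j hℓ (by omega) hs (by omega)).mpr (Or.inr h.1)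
    · exact (subband_two_exact ℓ s t hℓ (by omega) (by omega) hs).2 j h.1 h.2

end C047

end TriangleCap

end PercRepro
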